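import Summits.BirchSwinnertonDyer.BirchSwinnertonDyer.Theorems.Rank2Observatory2DescRowCert
import Literature.NumberTheory.EllipticCurves.BSDInvariantsProofs
import Mathlib.AlgebraicGeometry.EllipticCurve.VariableChange
import Summits.BirchSwinnertonDyer.BirchSwinnertonDyer.Theorems.Rank2ObservatoryRank2Table
import HarnessLib

/-!
# BirchSwinnertonDyer — rank ≥ 2 observatory: ROW CERTIFICATES — soundness of the kernel checker, `rank E(ℚ) ≤ 2` (KERNEL-2DESC v2.0, S2b)

HONEST FRAMING: per-curve certified theorems and census instruments; no claim on BSD in rank ≥ 2.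

Generic addendum of the KERNEL-2DESC instrument (design `b2b-bsdr2-cert-3/KERNEL-2DESC.md` §12, the
RESHAPE to sharded row files). `rank_le_two_of_check`: for a monogenic complex cubic field context
(`K = ℚ(α)` with its landed field file: irreducibility, `finrank = 3`, PID, the unit family spanning
`𝓞_K^× / squares` with coordinates, norms and real signs, an isolating interval of `ρ(α)`) and a curve row
`cc : CurveCert m` with `cc.check … = true` (kernel) plus the `norm_num` primality of the listed rational
primes, the curve `y² = x³ + cc.A x² + cc.B x + cc.C` has `rank E(ℚ) ≤ 2`. The proof is the v1.x per-curve
template (`gen_percurve5.py`: `aeval_theta`, `deriv_fac`, `support_deriv`, `adm_sound`, `admQ_sound`,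
`kill_cert`, `admK_sound`, `mordellWeilRank_le_two`) done ONCE with variables, ending in
`mordellWeilRank_le_of_coverSet_lt` (killed classes: the landed list-kill generic `admKills_sound`);
`rank_eq_two_of_check_complSq` handles curves certified on their completed-square model and
`two_le_rank_of_row` bridges the tree's table-row lower bounds; `rank_eq_two_of_check` adds the tree lower bound. Sorry-free; axioms
`propext`, `Classical.choice`, `Quot.sound`. [folklore]
[cite: Cassels1991LecturesEllipticCurves, §15] [cite: CremonaAlgorithms1997, §3.6]
-/

-- single-conjunct summit: `Summit.BirchSwinnertonDyer.BirchSwinnertonDyer.…` repeats the name by design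
set_option linter.dupNamespace false

open scoped NumberField

open Literature.NumberTheory.NumberFields Polynomial Module NumberField

namespace Summit.BirchSwinnertonDyer.BirchSwinnertonDyer.Rank2Observatory.TwoDescCubic

section assembly

variable {K : Type*} [Field K] [NumberField K] {a b c : ℤ} {α : K}

/-- **Soundness of the row checker: `rank E(ℚ) ≤ 2`.** [cite: Cassels1991LecturesEllipticCurves, §15] -/
theorem rank_le_two_of_check [IsPrincipalIdealRing (𝓞 K)]
    (hirr : Irreducible (MonicCubic.polyQ a b c)) (hα : aeval α (MonicCubic.poly a b c) = 0)
    (h3 : finrank ℚ K = 3) {m : ℕ} (Wu : Fin m → (𝓞 K)ˣ)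
    (hW : ∀ u : (𝓞 K)ˣ, ∃ T : Finset (Fin m), IsSquare (u * ∏ i ∈ T, Wu i))
    (ucoords : Fin m → ℤ × ℤ × ℤ)
    (hWu : ∀ i, ((Wu i : (𝓞 K)ˣ) : 𝓞 K) = lin hα (ucoords i).1 (ucoords i).2.1 (ucoords i).2.2)
    {Nu : Fin m → ℤ} (hNu : ∀ i, Algebra.norm ℚ (((Wu i : (𝓞 K)ˣ) : 𝓞 K) : K) = Nu i)
    (ρ : K →+* ℝ) {lo hi : ℚ} (h0 : 0 ≤ lo) (hlo : ((lo : ℚ) : ℝ) < ρ α) (hhi : ρ α < ((hi : ℚ) : ℝ))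
    {su : Fin m → Bool} (hsu : ∀ i, (su i = true ↔ ρ (((Wu i : (𝓞 K)ˣ) : 𝓞 K) : K) < 0))
    (cc : CurveCert m) (hc : cc.check a b c lo hi ucoords Nu su = true)
    (hprimes : (cc.gens.map GenData.p).Forall Nat.Prime) :
    ((⟨0, cc.A, 0, cc.B, cc.C⟩ : WeierstrassCurve ℚ)).mordellWeilRank ≤ 2 := by
  classical
  have hprimes' : ∀ d ∈ cc.gens, d.p.Prime := fun d hd =>
    (List.forall_iff_forall_mem.mp hprimes) _ (List.mem_map.mpr ⟨d, hd, rfl⟩)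
  simp only [CurveCert.check, Bool.and_eq_true, decide_eq_true_eq, List.all_eq_true] at hc
  obtain ⟨⟨⟨⟨⟨⟨⟨⟨⟨⟨⟨hΔ, hirrF⟩, hθ⟩, hder⟩, huinv⟩, hgens⟩, hnodup⟩, hdisc⟩, hQ⟩, hkill⟩, hTU⟩, hcount⟩ := hc
  haveI hE := isElliptic_of_deltaShort_ne hΔ
  have hirrF' := irreducible_of_noRootMod hirrF
  have haev := aeval_lin_eq_zero_of_coords hα cc.t hθ
  -- the generators
  set s := cc.gens.length with hs
  set G : Fin s → 𝓞 K := fun j => lin hα (cc.gens.get j).g.1 (cc.gens.get j).g.2.1 (cc.gens.get j).g.2.2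
    with hG
  have hGchk : ∀ j : Fin s, (cc.gens.get j).check a b c lo hi = true := fun j => hgens _ (List.get_mem _ _)
  have hGp : ∀ j, Prime (G j) := fun j =>
    GenData.prime_of_check hirr hα h3 (hGchk j) (hprimes' _ (List.get_mem _ _))
  have hGi : Function.Injective G := by
    intro i j hij
    by_contra hne
    have hgne : (cc.gens.get i).g ≠ (cc.gens.get j).g := by
      intro hg
      apply hne
      have hinj := List.inj_on_of_nodup_map hnodup
      have heq : cc.gens.get i = cc.gens.get j := hinj (List.get_mem _ _) (List.get_mem _ _) hg
      exact (List.Nodup.get_inj_iff (List.Nodup.of_map _ hnodup)).mp heq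
    have hne3 : (cc.gens.get i).g.1 ≠ (cc.gens.get j).g.1 ∨ (cc.gens.get i).g.2.1 ≠ (cc.gens.get j).g.2.1 ∨
        (cc.gens.get i).g.2.2 ≠ (cc.gens.get j).g.2.2 := by
      by_contra hcon
      simp only [ne_eq, not_or, not_not] at hcon
      exact hgne (Prod.ext hcon.1 (Prod.ext hcon.2.1 hcon.2.2))
    exact lin_ne hirr hα h3 hne3 hij
  -- the support of F′(θ)
  have hu : IsUnit (lin hα cc.u.1 cc.u.2.1 cc.u.2.2) := isUnit_lin_of_coords hα cc.u cc.uinv huinv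
  have hder' := deriv_eq_of_coords hα cc.t cc.u (cc.gens.map fun d => (d.g, d.e)) hder
  have hD : ∀ q : 𝓞 K, Prime q →
      q ∣ 3 * (lin hα cc.t.1 cc.t.2.1 cc.t.2.2) ^ 2 + 2 * (cc.A : 𝓞 K) * (lin hα cc.t.1 cc.t.2.1 cc.t.2.2) + (cc.B : 𝓞 K) →
      ∃ j, Associated q (G j) := by
    intro q hq hdvd
    have hdvd' : q ∣ lin hα cc.u.1 cc.u.2.1 cc.u.2.2 *
        ((cc.gens.map fun d => (d.g, d.e)).map fun ge => (lin hα ge.1.1 ge.1.2.1 ge.1.2.2) ^ ge.2).prod := by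
      have e : (3 : 𝓞 K) * (lin hα cc.t.1 cc.t.2.1 cc.t.2.2) ^ 2 + 2 * ((cc.A : ℤ) : 𝓞 K) * (lin hα cc.t.1 cc.t.2.1 cc.t.2.2) +
          ((cc.B : ℤ) : 𝓞 K) = _ := hder'
      rw [← e]
      simpa using hdvd
    rcases hq.dvd_or_dvd hdvd' with h1 | h1
    · exact absurd (isUnit_of_dvd_unit h1 hu) hq.not_unit
    rw [List.map_map] at h1
    obtain ⟨x, hx, hqx⟩ := (Prime.dvd_prod_iff hq).mp h1
    rw [List.mem_map] at hx
    obtain ⟨d, hd, rfl⟩ := hx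
    obtain ⟨j, hj⟩ := List.mem_iff_get.mp hd
    refine ⟨j, ?_⟩
    have hqd : q ∣ lin hα d.g.1 d.g.2.1 d.g.2.2 := hq.dvd_of_dvd_pow hqx
    have hGj : G j = lin hα d.g.1 d.g.2.1 d.g.2.2 := by simp only [hG, hj]
    rw [hGj]
    exact hq.associated_of_dvd (hj ▸ hGp j) hqd
  -- admissibility
  have hq := cofactor_pos_of_disc_neg (rho_theta_root ρ haev) hdisc
  have hQpos : ∀ q ∈ cc.Q, 0 < q := fun q hq' => hQ q hq'
  have hadm : ∀ x y : ℚ, y ^ 2 = x ^ 3 + cc.A * x ^ 2 + cc.B * x + cc.C →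
      ∀ (T : Finset (Fin m)) (U : Finset (Fin s)),
        IsSquare ((algebraMap ℚ K x - algebraMap (𝓞 K) K (lin hα cc.t.1 cc.t.2.1 cc.t.2.2)) *
          (∏ i ∈ T, algebraMap (𝓞 K) K (Wu i)) * ∏ j ∈ U, algebraMap (𝓞 K) K (G j)) →
        cc.adm a b c ucoords Nu su T U = true := by
    intro x y hxy T U hsq
    have hstd := admStd_sound hirrF' haev h3 ρ hq
      (w := fun i => algebraMap (𝓞 K) K (Wu i)) (g := fun j => algebraMap (𝓞 K) K (G j))
      (fun i => (RingOfIntegers.coe_ne_zero_iff).mpr (Units.ne_zero _))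
      (fun j => (RingOfIntegers.coe_ne_zero_iff).mpr (hGp j).ne_zero)
      (Nu := Nu) (fun i => hNu i)
      (Ng := fun j => (cc.gens.get j).n) (fun j => GenData.norm_of_check hirr hα h3 (hGchk j))
      (su := su) hsu
      (sg := fun j => (cc.gens.get j).sg) (fun j => GenData.sign_iff_of_check hα ρ h0 hlo hhi (hGchk j))
      x y hxy T U hsq
    have hstdQ := admStdQ_of_admStd (Q := cc.Q) hQpos hstd
    exact admKills_sound hirr hα h3 cc.t.1 (fun i => ((Wu i : (𝓞 K)ˣ) : 𝓞 K)) G hWu (fun j => rfl) hkill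
      hstdQ x hsq
  -- the count
  exact mordellWeilRank_le_of_coverSet_lt (A := cc.A) (B := cc.B) (C := cc.C)
    (⟨0, cc.A, 0, cc.B, cc.C⟩ : WeierstrassCurve ℚ) rfl rfl rfl rfl rfl hirrF' haev h3 hGi
    (fun j => (hGp j).ne_zero) hD hW
    (adm := cc.adm a b c ucoords Nu su) (admKills_empty (admStdQ_empty cc.Q hQpos _ _ _ _)
      (List.all_eq_true.mpr hTU)) hadm hcount

/-- **`rank E(ℚ) = 2` from a checked row and the tree's lower bound** (the shape of every sharded
per-curve declaration: `rank_eq_two_of_check <field data…> ⟨row⟩ (by decide +kernel) (by norm_num …)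
KernelCerts<N>.C<label>.two_le_rank`). [cite: CremonaAlgorithms1997, §3.6] -/
theorem rank_eq_two_of_check [IsPrincipalIdealRing (𝓞 K)]
    (hirr : Irreducible (MonicCubic.polyQ a b c)) (hα : aeval α (MonicCubic.poly a b c) = 0)
    (h3 : finrank ℚ K = 3) {m : ℕ} (Wu : Fin m → (𝓞 K)ˣ)
    (hW : ∀ u : (𝓞 K)ˣ, ∃ T : Finset (Fin m), IsSquare (u * ∏ i ∈ T, Wu i))
    (ucoords : Fin m → ℤ × ℤ × ℤ)
    (hWu : ∀ i, ((Wu i : (𝓞 K)ˣ) : 𝓞 K) = lin hα (ucoords i).1 (ucoords i).2.1 (ucoords i).2.2)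
    {Nu : Fin m → ℤ} (hNu : ∀ i, Algebra.norm ℚ (((Wu i : (𝓞 K)ˣ) : 𝓞 K) : K) = Nu i)
    (ρ : K →+* ℝ) {lo hi : ℚ} (h0 : 0 ≤ lo) (hlo : ((lo : ℚ) : ℝ) < ρ α) (hhi : ρ α < ((hi : ℚ) : ℝ))
    {su : Fin m → Bool} (hsu : ∀ i, (su i = true ↔ ρ (((Wu i : (𝓞 K)ˣ) : 𝓞 K) : K) < 0))
    (cc : CurveCert m) (hc : cc.check a b c lo hi ucoords Nu su = true)
    (hprimes : (cc.gens.map GenData.p).Forall Nat.Prime)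
    (hlow : 2 ≤ (((⟨0, cc.A, 0, cc.B, cc.C⟩ : WeierstrassCurve ℤ)).map (Int.castRingHom ℚ)).mordellWeilRank) :
    (((⟨0, cc.A, 0, cc.B, cc.C⟩ : WeierstrassCurve ℤ)).map (Int.castRingHom ℚ)).mordellWeilRank = 2 := by
  have hE : ((⟨0, cc.A, 0, cc.B, cc.C⟩ : WeierstrassCurve ℤ)).map (Int.castRingHom ℚ) =
      (⟨0, cc.A, 0, cc.B, cc.C⟩ : WeierstrassCurve ℚ) := by
    ext <;> simp [WeierstrassCurve.map]
  refine le_antisymm ?_ hlow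
  rw [hE]
  exact rank_le_two_of_check hirr hα h3 Wu hW ucoords hWu hNu ρ h0 hlo hhi hsu cc hc hprimes

/-- **`rank E(ℚ) = 2` for the ORIGINAL model** `(a₁, a₂, a₃, a₄, a₆)` when the row certifies its completed-square
model `(0, a₁² + 4a₂, 0, 8(a₁a₃ + 2a₄), 16(a₃² + 4a₆))` (`x = x′/4`, `y = y′/8 − (a₁x + a₃)/2`; the rank is
invariant, `mordellWeilRank_variableChange`). [cite: CremonaAlgorithms1997, §3.6] -/
theorem rank_eq_two_of_check_complSq [IsPrincipalIdealRing (𝓞 K)]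
    (hirr : Irreducible (MonicCubic.polyQ a b c)) (hα : aeval α (MonicCubic.poly a b c) = 0)
    (h3 : finrank ℚ K = 3) {m : ℕ} (Wu : Fin m → (𝓞 K)ˣ)
    (hW : ∀ u : (𝓞 K)ˣ, ∃ T : Finset (Fin m), IsSquare (u * ∏ i ∈ T, Wu i))
    (ucoords : Fin m → ℤ × ℤ × ℤ)
    (hWu : ∀ i, ((Wu i : (𝓞 K)ˣ) : 𝓞 K) = lin hα (ucoords i).1 (ucoords i).2.1 (ucoords i).2.2)
    {Nu : Fin m → ℤ} (hNu : ∀ i, Algebra.norm ℚ (((Wu i : (𝓞 K)ˣ) : 𝓞 K) : K) = Nu i)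
    (ρ : K →+* ℝ) {lo hi : ℚ} (h0 : 0 ≤ lo) (hlo : ((lo : ℚ) : ℝ) < ρ α) (hhi : ρ α < ((hi : ℚ) : ℝ))
    {su : Fin m → Bool} (hsu : ∀ i, (su i = true ↔ ρ (((Wu i : (𝓞 K)ˣ) : 𝓞 K) : K) < 0))
    (cc : CurveCert m) (hc : cc.check a b c lo hi ucoords Nu su = true)
    (hprimes : (cc.gens.map GenData.p).Forall Nat.Prime) (a₁ a₂ a₃ a₄ a₆ : ℤ)
    (hABC : cc.A = a₁ ^ 2 + 4 * a₂ ∧ cc.B = 8 * (a₁ * a₃ + 2 * a₄) ∧ cc.C = 16 * (a₃ ^ 2 + 4 * a₆))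
    (hlow : 2 ≤ (((⟨a₁, a₂, a₃, a₄, a₆⟩ : WeierstrassCurve ℤ)).map (Int.castRingHom ℚ)).mordellWeilRank) :
    (((⟨a₁, a₂, a₃, a₄, a₆⟩ : WeierstrassCurve ℤ)).map (Int.castRingHom ℚ)).mordellWeilRank = 2 := by
  obtain ⟨hA, hB, hC⟩ := hABC
  have hE : ((⟨0, cc.A, 0, cc.B, cc.C⟩ : WeierstrassCurve ℤ)).map (Int.castRingHom ℚ) =
      (⟨0, cc.A, 0, cc.B, cc.C⟩ : WeierstrassCurve ℚ) := by
    ext <;> simp [WeierstrassCurve.map]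
  have hV : ((⟨0, cc.A, 0, cc.B, cc.C⟩ : WeierstrassCurve ℤ)).map (Int.castRingHom ℚ) =
      (⟨Units.mk0 (1 / 2 : ℚ) (by norm_num), 0, -(a₁ : ℚ) / 2, -(a₃ : ℚ) / 2⟩ :
        WeierstrassCurve.VariableChange ℚ) •
        (((⟨a₁, a₂, a₃, a₄, a₆⟩ : WeierstrassCurve ℤ)).map (Int.castRingHom ℚ)) := by
    ext <;> simp only [WeierstrassCurve.map_a₁, WeierstrassCurve.map_a₂, WeierstrassCurve.map_a₃,
      WeierstrassCurve.map_a₄, WeierstrassCurve.map_a₆, WeierstrassCurve.variableChange_a₁,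
      WeierstrassCurve.variableChange_a₂, WeierstrassCurve.variableChange_a₃,
      WeierstrassCurve.variableChange_a₄, WeierstrassCurve.variableChange_a₆, Units.val_inv_eq_inv_val,
      Units.val_mk0, hA, hB, hC, eq_intCast, Int.cast_zero] <;> push_cast <;> ring
  have hr : (((⟨0, cc.A, 0, cc.B, cc.C⟩ : WeierstrassCurve ℤ)).map (Int.castRingHom ℚ)).mordellWeilRank =
      (((⟨a₁, a₂, a₃, a₄, a₆⟩ : WeierstrassCurve ℤ)).map (Int.castRingHom ℚ)).mordellWeilRank := by
    rw [hV]; exact WeierstrassCurve.mordellWeilRank_variableChange_holds _ _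
  rw [← hr] at hlow ⊢
  refine le_antisymm ?_ hlow
  rw [hE]
  exact rank_le_two_of_check hirr hα h3 Wu hW ucoords hWu hNu ρ h0 hlo hhi hsu cc hc hprimes

/-- **Lower-bound bridge from a census table row** (`Rank2Row.curve r` is the `ℚ`-model of the integer
Weierstrass data of `r`): the walker-list certificates state `2 ≤ rank` for `r.curve`. [folklore] -/
theorem two_le_rank_of_row (r : Rank2Row) (h : 2 ≤ r.curve.mordellWeilRank) :
    2 ≤ (((⟨r.a₁, r.a₂, r.a₃, r.a₄, r.a₆⟩ : WeierstrassCurve ℤ)).map (Int.castRingHom ℚ)).mordellWeilRank := by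
  have hc : r.curve = ((⟨r.a₁, r.a₂, r.a₃, r.a₄, r.a₆⟩ : WeierstrassCurve ℤ)).map (Int.castRingHom ℚ) := by
    ext <;> simp [Rank2Row.curve, WeierstrassCurve.map]
  rwa [hc] at h

end assembly

end Summit.BirchSwinnertonDyer.BirchSwinnertonDyer.Rank2Observatory.TwoDescCubic
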